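import Summits.ValiantsHypothesis.ValiantsHypothesis.Theorems.GeneratorObstructionsPerGenDegreeSuperQPFermatChow

/-!
# Route GeneratorObstructions — K1 `PerGenDegreeSuperQP` (stmt-ValiantsHypothesis-11654),
# line `per-side-atoms`: the binomial `(y₁⋯y_r)^t + (w₁⋯w_p)^u` is polystable
# (towards: every ray `j = r + p`, `r, p ∣ m`, of `S(per_m)` is hit — companion `…TwoMonomialsRay`)

Eighteenth support file of the line; generalises `…FermatChow` (`r = m`, `t = 1`, `p = 1`,
`u = m`). For `m = r t = p u` the form `Q = (y₁⋯y_r)^t + (w₁⋯w_p)^u` of degree `m` in the `r + p`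
variables `y_u, w_s` is `per_m(M)` for the matrix `M` with diagonal entries `y_{a(i)}` and cyclic
sub-diagonal entries `w_{b(i)}` (`a, b` balanced labellings) — companion file. Here:

* `twoMonomials_eq`, `coeff_twoMonomials`, `support_twoMonomials` — `Q` as the sum of the two
  monomials with exponents `t·𝟙_Y` and `u·𝟙_W`;
* `twoMonomials_separating` — for `r ≥ 2` any two variables are separated by a diagonal
  substitution fixing `Q` (`y_{u₀} ↦ 2y_{u₀}, y_{u₁} ↦ y_{u₁}/2`, or the same on the `w`-block);
* `twoMonomials_posCone` — `(1,…,1) = (1/t)·t𝟙_Y + (1/u)·u𝟙_W` with positive coefficients;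
* `isPolystable_twoMonomials` — hence `Q` is POLYSTABLE (BI 2017 Prop. 2.8, corrected form,
  tree `isPolystable_of_separating_diagonalStabilizers`), for `r ≥ 2`, `p, t, u ≥ 1`, `r t = p u`.

Honest framing: elementary invariant theory of a binomial; `stub_atomLate` (`c ≥ 2`), K1 and
`GenFlipThesis` remain OPEN; nothing here bears on VP versus VNP.
References: [BurgisserIkenmeyer2017] Prop. 2.8 (corrected, tree erratum A31), Cor. 2.9.
-/

set_option linter.dupNamespace false

noncomputable section

namespace Summit.ValiantsHypothesis.ValiantsHypothesis.Theorems.GeneratorObstructions.PerGenDegreeSuperQP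

open MvPolynomial
open Literature.NumberTheory.DiophantineGeometry Literature.Computability.AlgebraicComplexity
  Literature.Computability.Complexity

section TwoMonomials

variable {r p t u : ℕ}

/-- `castAdd` and `natAdd` letters are distinct. [folklore] -/
theorem castAdd_ne_natAdd (a : Fin r) (s : Fin p) : (Fin.castAdd p a : Fin (r + p)) ≠ Fin.natAdd r s := by
  intro h
  have := congrArg Fin.val h
  simp at this
  omega

/-- The binomial as a sum of two monomials with exponents `t·𝟙_Y`, `u·𝟙_W`. [folklore] -/
theorem twoMonomials_eq (r p t u : ℕ) :
    ((∏ a : Fin r, X (Fin.castAdd p a)) ^ t + (∏ s : Fin p, X (Fin.natAdd r s)) ^ u :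
        MvPolynomial (Fin (r + p)) ℂ) =
      monomial (t • ∑ a : Fin r, Finsupp.single (Fin.castAdd p a) 1) 1 +
        monomial (u • ∑ s : Fin p, Finsupp.single (Fin.natAdd r s) 1) 1 := by
  rw [show (∏ a : Fin r, X (Fin.castAdd p a) : MvPolynomial (Fin (r + p)) ℂ) =
      monomial (∑ a : Fin r, Finsupp.single (Fin.castAdd p a) 1) 1 from by rw [monomial_sum_one]; rfl,
    show (∏ s : Fin p, X (Fin.natAdd r s) : MvPolynomial (Fin (r + p)) ℂ) =
      monomial (∑ s : Fin p, Finsupp.single (Fin.natAdd r s) 1) 1 from by rw [monomial_sum_one]; rfl,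
    monomial_pow, monomial_pow, one_pow, one_pow]

/-- The exponent `𝟙_Y` at the letters. [folklore] -/
theorem expY_apply_castAdd (a : Fin r) :
    (∑ a' : Fin r, Finsupp.single (Fin.castAdd p a') 1 : Fin (r + p) →₀ ℕ) (Fin.castAdd p a) = 1 := by
  classical
  rw [Finsupp.coe_finsetSum, Finset.sum_apply]
  simp [Finsupp.single_apply, (Fin.castAdd_injective r p).eq_iff]

/-- `𝟙_Y` vanishes on the `w`-letters. [folklore] -/
theorem expY_apply_natAdd (s : Fin p) :
    (∑ a' : Fin r, Finsupp.single (Fin.castAdd p a') 1 : Fin (r + p) →₀ ℕ) (Fin.natAdd r s) = 0 := by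
  classical
  rw [Finsupp.coe_finsetSum, Finset.sum_apply]
  simp [castAdd_ne_natAdd]

/-- The exponent `𝟙_W` at the letters. [folklore] -/
theorem expW_apply_natAdd (s : Fin p) :
    (∑ s' : Fin p, Finsupp.single (Fin.natAdd r s') 1 : Fin (r + p) →₀ ℕ) (Fin.natAdd r s) = 1 := by
  classical
  rw [Finsupp.coe_finsetSum, Finset.sum_apply]
  simp [Finsupp.single_apply]

/-- `𝟙_W` vanishes on the `y`-letters. [folklore] -/
theorem expW_apply_castAdd (a : Fin r) :
    (∑ s' : Fin p, Finsupp.single (Fin.natAdd r s') 1 : Fin (r + p) →₀ ℕ) (Fin.castAdd p a) = 0 := by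
  classical
  rw [Finsupp.coe_finsetSum, Finset.sum_apply]
  simp [fun s => (castAdd_ne_natAdd a s).symm]

/-- The two exponents differ (`r, t ≥ 1`). [folklore] -/
theorem twoMonomials_exp_ne (hr : 0 < r) (ht : 0 < t) :
    (t • ∑ a : Fin r, Finsupp.single (Fin.castAdd p a) 1 : Fin (r + p) →₀ ℕ) ≠
      u • ∑ s : Fin p, Finsupp.single (Fin.natAdd r s) 1 := by
  intro h
  have := congrArg (fun e => e (Fin.castAdd p ⟨0, hr⟩)) h
  simp only [Finsupp.coe_smul, Pi.smul_apply, smul_eq_mul, expY_apply_castAdd, expW_apply_castAdd,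
    mul_one, mul_zero] at this
  omega

/-- Coefficients of the binomial. [folklore] -/
theorem coeff_twoMonomials (α : Fin (r + p) →₀ ℕ) :
    coeff α ((∏ a : Fin r, X (Fin.castAdd p a)) ^ t + (∏ s : Fin p, X (Fin.natAdd r s)) ^ u :
        MvPolynomial (Fin (r + p)) ℂ) =
      (if (t • ∑ a : Fin r, Finsupp.single (Fin.castAdd p a) 1 : Fin (r + p) →₀ ℕ) = α then 1 else 0) +
        (if (u • ∑ s : Fin p, Finsupp.single (Fin.natAdd r s) 1 : Fin (r + p) →₀ ℕ) = α then 1 else 0) := by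
  classical
  rw [twoMonomials_eq, coeff_add, coeff_monomial, coeff_monomial]

/-- The support of the binomial (`r, t ≥ 1`). [folklore] -/
theorem support_twoMonomials (hr : 0 < r) (ht : 0 < t) :
    ((∏ a : Fin r, X (Fin.castAdd p a)) ^ t + (∏ s : Fin p, X (Fin.natAdd r s)) ^ u :
        MvPolynomial (Fin (r + p)) ℂ).support =
      {(t • ∑ a : Fin r, Finsupp.single (Fin.castAdd p a) 1 : Fin (r + p) →₀ ℕ),
        u • ∑ s : Fin p, Finsupp.single (Fin.natAdd r s) 1} := by
  classical
  ext α
  rw [mem_support_iff, coeff_twoMonomials, Finset.mem_insert, Finset.mem_singleton]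
  have hne := twoMonomials_exp_ne (p := p) (u := u) hr ht
  by_cases h1 : (t • ∑ a : Fin r, Finsupp.single (Fin.castAdd p a) 1 : Fin (r + p) →₀ ℕ) = α
  · subst h1
    rw [if_pos rfl, if_neg hne.symm]
    simp
  · by_cases h2 : (u • ∑ s : Fin p, Finsupp.single (Fin.natAdd r s) 1 : Fin (r + p) →₀ ℕ) = α
    · subst h2
      rw [if_neg h1, if_pos rfl]
      simp
    · simp only [if_neg h1, if_neg h2, add_zero, ne_eq, not_true_eq_false, false_iff, not_or]
      exact ⟨Ne.symm h1, Ne.symm h2⟩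

/-- The binomial is a form of degree `m` when `r t = m = p u`. [folklore] -/
theorem twoMonomials_isHomogeneous {m : ℕ} (hrt : r * t = m) (hpu : p * u = m) :
    ((∏ a : Fin r, X (Fin.castAdd p a)) ^ t + (∏ s : Fin p, X (Fin.natAdd r s)) ^ u :
        MvPolynomial (Fin (r + p)) ℂ).IsHomogeneous m := by
  refine IsHomogeneous.add ?_ ?_
  · have h := IsHomogeneous.prod (Finset.univ : Finset (Fin r))
      (fun a => (X (Fin.castAdd p a) : MvPolynomial (Fin (r + p)) ℂ)) (fun _ => 1)
      (fun a _ => isHomogeneous_X ℂ (Fin.castAdd p a))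
    have h' := h.pow t
    simpa [hrt] using h'
  · have h := IsHomogeneous.prod (Finset.univ : Finset (Fin p))
      (fun s => (X (Fin.natAdd r s) : MvPolynomial (Fin (r + p)) ℂ)) (fun _ => 1)
      (fun s _ => isHomogeneous_X ℂ (Fin.natAdd r s))
    have h' := h.pow u
    simpa [hpu] using h'

/-- The binomial is nonzero (`r, t ≥ 1`). [folklore] -/
theorem twoMonomials_ne_zero (hr : 0 < r) (ht : 0 < t) :
    ((∏ a : Fin r, X (Fin.castAdd p a)) ^ t + (∏ s : Fin p, X (Fin.natAdd r s)) ^ u :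
        MvPolynomial (Fin (r + p)) ℂ) ≠ 0 := by
  intro h
  have := support_twoMonomials (p := p) (u := u) hr ht
  rw [h, support_zero] at this
  exact absurd (this ▸ Finset.mem_insert_self _ _) (Finset.notMem_empty _)

/-- A block bump fixes the binomial: scaling two letters OF THE SAME BLOCK by `2` and `1/2`.
[cite: BurgisserIkenmeyer2017, Prop. 2.8 and Cor. 2.9 (proof)] -/
theorem linSubst_bump_twoMonomials (x₀ x₁ : Fin (r + p)) (hx : x₀ ≠ x₁)
    (hsame : (∃ a₀ a₁ : Fin r, x₀ = Fin.castAdd p a₀ ∧ x₁ = Fin.castAdd p a₁) ∨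
      (∃ s₀ s₁ : Fin p, x₀ = Fin.natAdd r s₀ ∧ x₁ = Fin.natAdd r s₁)) :
    linSubst (Fin (r + p)) ℂ (Matrix.diagonal fun x : Fin (r + p) =>
        if x = x₀ then (2 : ℂ) else if x = x₁ then 1 / 2 else 1)
        ((∏ a : Fin r, X (Fin.castAdd p a)) ^ t + (∏ s : Fin p, X (Fin.natAdd r s)) ^ u :
          MvPolynomial (Fin (r + p)) ℂ) =
      (∏ a : Fin r, X (Fin.castAdd p a)) ^ t + (∏ s : Fin p, X (Fin.natAdd r s)) ^ u := by
  classical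
  set d : Fin (r + p) → ℂ := fun x => if x = x₀ then (2 : ℂ) else if x = x₁ then 1 / 2 else 1 with hd
  have hY : linSubst (Fin (r + p)) ℂ (Matrix.diagonal d)
      (∏ a : Fin r, X (Fin.castAdd p a) : MvPolynomial (Fin (r + p)) ℂ) =
      (∏ a : Fin r, d (Fin.castAdd p a)) • ∏ a : Fin r, X (Fin.castAdd p a) := by
    rw [show (∏ a : Fin r, X (Fin.castAdd p a) : MvPolynomial (Fin (r + p)) ℂ) =
      monomial (∑ a : Fin r, Finsupp.single (Fin.castAdd p a) 1) 1 from by rw [monomial_sum_one]; rfl,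
      linSubst_diagonal_monomial]
    congr 1
    rw [← Finsupp.prod_finsetSum_index (fun _ => pow_zero _) (fun _ _ _ => pow_add _ _ _)]
    refine Finset.prod_congr rfl fun a _ => ?_
    rw [Finsupp.prod_single_index (h := fun x n => d x ^ n) (pow_zero _), pow_one]
  have hW : linSubst (Fin (r + p)) ℂ (Matrix.diagonal d)
      (∏ s : Fin p, X (Fin.natAdd r s) : MvPolynomial (Fin (r + p)) ℂ) =
      (∏ s : Fin p, d (Fin.natAdd r s)) • ∏ s : Fin p, X (Fin.natAdd r s) := by
    rw [show (∏ s : Fin p, X (Fin.natAdd r s) : MvPolynomial (Fin (r + p)) ℂ) =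
      monomial (∑ s : Fin p, Finsupp.single (Fin.natAdd r s) 1) 1 from by rw [monomial_sum_one]; rfl,
      linSubst_diagonal_monomial]
    congr 1
    rw [← Finsupp.prod_finsetSum_index (fun _ => pow_zero _) (fun _ _ _ => pow_add _ _ _)]
    refine Finset.prod_congr rfl fun s _ => ?_
    rw [Finsupp.prod_single_index (h := fun x n => d x ^ n) (pow_zero _), pow_one]
  -- the two block products of `d`
  have hprodY : ∏ a : Fin r, d (Fin.castAdd p a) = 1 := by
    rcases hsame with ⟨a₀, a₁, rfl, rfl⟩ | ⟨s₀, s₁, rfl, rfl⟩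
    · have ha : a₀ ≠ a₁ := fun h => hx (by rw [h])
      rw [← prod_ite_ite_eq_one (ι := Fin r) ha]
      refine Finset.prod_congr rfl fun a _ => ?_
      simp only [hd, (Fin.castAdd_injective r p).eq_iff]
    · refine Finset.prod_eq_one fun a _ => ?_
      simp only [hd, if_neg (castAdd_ne_natAdd a s₀), if_neg (castAdd_ne_natAdd a s₁)]
  have hprodW : ∏ s : Fin p, d (Fin.natAdd r s) = 1 := by
    rcases hsame with ⟨a₀, a₁, rfl, rfl⟩ | ⟨s₀, s₁, rfl, rfl⟩
    · refine Finset.prod_eq_one fun s _ => ?_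
      simp only [hd, if_neg (castAdd_ne_natAdd a₀ s).symm, if_neg (castAdd_ne_natAdd a₁ s).symm]
    · have hs : s₀ ≠ s₁ := fun h => hx (by rw [h])
      rw [← prod_ite_ite_eq_one (ι := Fin p) hs]
      refine Finset.prod_congr rfl fun s _ => ?_
      simp only [hd, Fin.natAdd_inj]
  rw [map_add, map_pow, map_pow, hY, hW, hprodY, hprodW, one_smul, one_smul]

/-- **Separating diagonal stabilizers of the binomial** (`r ≥ 2`). [cite: BurgisserIkenmeyer2017, Prop. 2.8 and Cor. 2.9 (proof)] -/
theorem twoMonomials_separating (hr : 2 ≤ r) (x x' : Fin (r + p)) (hxx : x ≠ x') :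
    ∃ d : Fin (r + p) → ℂ,
      linSubst (Fin (r + p)) ℂ (Matrix.diagonal d)
          ((∏ a : Fin r, X (Fin.castAdd p a)) ^ t + (∏ s : Fin p, X (Fin.natAdd r s)) ^ u :
            MvPolynomial (Fin (r + p)) ℂ) =
        (∏ a : Fin r, X (Fin.castAdd p a)) ^ t + (∏ s : Fin p, X (Fin.natAdd r s)) ^ u ∧
      d x ≠ d x' := by
  classical
  haveI : Nontrivial (Fin r) := Fin.nontrivial_iff_two_le.mpr hr
  obtain ⟨y, rfl⟩ := finSumFinEquiv.surjective x
  obtain ⟨y', rfl⟩ := finSumFinEquiv.surjective x'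
  rcases y with a | s <;> rcases y' with a' | s' <;>
    simp only [finSumFinEquiv_apply_left, finSumFinEquiv_apply_right] at hxx ⊢
  · -- two `y`-letters
    refine ⟨_, linSubst_bump_twoMonomials _ _ hxx (Or.inl ⟨a, a', rfl, rfl⟩), ?_⟩
    simp only [if_neg (Ne.symm hxx), if_pos]
    norm_num
  · -- `y_a` versus `w_{s'}`: bump `y_a` against another `y`-letter
    obtain ⟨a₁, ha₁⟩ := exists_ne a
    refine ⟨_, linSubst_bump_twoMonomials (t := t) (u := u) _ _
      (fun h => ha₁ ((Fin.castAdd_injective r p) h).symm) (Or.inl ⟨a, a₁, rfl, rfl⟩), ?_⟩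
    simp only [if_neg (castAdd_ne_natAdd a s').symm, if_neg (castAdd_ne_natAdd a₁ s').symm]
    norm_num
  · -- `w_s` versus `y_{a'}`: bump `y_{a'}` against another `y`-letter
    obtain ⟨a₁, ha₁⟩ := exists_ne a'
    refine ⟨_, linSubst_bump_twoMonomials (t := t) (u := u) _ _
      (fun h => ha₁ ((Fin.castAdd_injective r p) h).symm) (Or.inl ⟨a', a₁, rfl, rfl⟩), ?_⟩
    simp only [if_neg (castAdd_ne_natAdd a' s).symm, if_neg (castAdd_ne_natAdd a₁ s).symm]
    norm_num
  · -- two `w`-letters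
    refine ⟨_, linSubst_bump_twoMonomials _ _ hxx (Or.inr ⟨s, s', rfl, rfl⟩), ?_⟩
    simp only [if_neg (Ne.symm hxx), if_pos]
    norm_num

/-- **Positive cone condition for the binomial**: `(1,…,1) = (1/t)·(t𝟙_Y) + (1/u)·(u𝟙_W)`.
[cite: BurgisserIkenmeyer2017, Prop. 2.8 and Cor. 2.9 (proof)] -/
theorem twoMonomials_posCone (hr : 0 < r) (ht : 0 < t) (hu : 0 < u) :
    ∃ c : (Fin (r + p) →₀ ℕ) → ℚ,
      (∀ α ∈ ((∏ a : Fin r, X (Fin.castAdd p a)) ^ t + (∏ s : Fin p, X (Fin.natAdd r s)) ^ u :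
          MvPolynomial (Fin (r + p)) ℂ).support, 0 < c α) ∧
      ∀ x : Fin (r + p),
        ∑ α ∈ ((∏ a : Fin r, X (Fin.castAdd p a)) ^ t + (∏ s : Fin p, X (Fin.natAdd r s)) ^ u :
          MvPolynomial (Fin (r + p)) ℂ).support, c α * (α x : ℚ) = 1 := by
  classical
  refine ⟨fun α => if α = (u • ∑ s : Fin p, Finsupp.single (Fin.natAdd r s) 1 : Fin (r + p) →₀ ℕ)
      then 1 / (u : ℚ) else 1 / (t : ℚ), ?_, ?_⟩
  · intro α _
    have : (0 : ℚ) < t := by exact_mod_cast ht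
    have : (0 : ℚ) < u := by exact_mod_cast hu
    dsimp only
    split_ifs <;> positivity
  · intro x
    have hne := twoMonomials_exp_ne (p := p) (u := u) hr ht
    rw [support_twoMonomials hr ht, Finset.sum_pair hne]
    dsimp only
    rw [if_neg hne, if_pos rfl]
    have ht' : (t : ℚ) ≠ 0 := by exact_mod_cast ht.ne'
    have hu' : (u : ℚ) ≠ 0 := by exact_mod_cast hu.ne'
    obtain ⟨y, rfl⟩ := finSumFinEquiv.surjective x
    rcases y with a | s
    · simp only [finSumFinEquiv_apply_left, Finsupp.coe_smul, Pi.smul_apply, smul_eq_mul,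
        expY_apply_castAdd, expW_apply_castAdd, mul_one, mul_zero, Nat.cast_zero, add_zero]
      field_simp
    · simp only [finSumFinEquiv_apply_right, Finsupp.coe_smul, Pi.smul_apply, smul_eq_mul,
        expY_apply_natAdd, expW_apply_natAdd, mul_one, mul_zero, Nat.cast_zero, zero_add]
      field_simp

/-- **The binomial `(y₁⋯y_r)^t + (w₁⋯w_p)^u` is polystable** (`r ≥ 2`, `p, t, u ≥ 1`,
`r t = p u`). [cite: BurgisserIkenmeyer2017, Prop. 2.8] -/
theorem isPolystable_twoMonomials {m : ℕ} (hr : 2 ≤ r) (ht : 0 < t) (hu : 0 < u)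
    (hrt : r * t = m) (hpu : p * u = m) :
    IsPolystable ((∏ a : Fin r, X (Fin.castAdd p a)) ^ t + (∏ s : Fin p, X (Fin.natAdd r s)) ^ u :
      MvPolynomial (Fin (r + p)) ℂ) := by
  obtain ⟨c, hcpos, hc⟩ := twoMonomials_posCone (p := p) (by omega : 0 < r) ht hu
  exact isPolystable_of_separating_diagonalStabilizers _ (twoMonomials_isHomogeneous hrt hpu)
    (fun x x' hxx => twoMonomials_separating hr x x' hxx) c hcpos hc

end TwoMonomials

end Summit.ValiantsHypothesis.ValiantsHypothesis.Theorems.GeneratorObstructions.PerGenDegreeSuperQP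

end
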